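import Summits.QuantumFields.YangMills.Theorems.FluctuationComparisonRegPrIntLS1aFreshLetterHaar
import Summits.QuantumFields.YangMills.Theorems.FluctuationComparisonRegPrIntLS1aFibreOpenMember
import Literature.MathematicalPhysics.QuantumFieldTheory.Balaban1983to89.AveragingReflection
import Literature.MathematicalPhysics.QuantumFieldTheory.Balaban1983to89.BlockAveragingExpMeanLogContinuous
import HarnessLib

/-!
# `FluctuationComparisonRegPrIntLS1aGuardSphereNull` — THE GUARD SPHERES OF ONE (0.4) STEP ARE PRODUCT-HAAR-NULL: every off-central loop variable
# `U(Γ ∪ [x,x′] ∪ (−Γ′) ∪ (−c))` of [Balaban1987RG1] (0.4) is HAAR-DISTRIBUTED under product Haar measure (its transported segment's MIDDLE bond is traversed exactly once),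
# every central one is `1`; hence on `SU(n)` every sphere `{dist1 U(loop) = r}`, `r ≠ 0`, is `dU`-null and THE FRONTIER OF THE SMALL-FIELD GUARD `{U | Small ℰ U c}` IS `dU`-NULL

Cell `ym3-torus` (HUMAN RULING D-0037: rung R3 = continuum SU(2) Yang–Mills on T³ — NOT d = 4, NOT infinite volume, NOT a mass gap, NOT Clay), WIDTH COPY «width 17»
of ym3-torus-p1, seat `ym3-torus-px17` gen 20; `--kind proof --supports stmt-QuantumFields-20520 --as helper` (count-neutral).  THEOREMS ONLY (no `def`, no `sorry`,
no `instance`, no `notation`, default heartbeats).  FILE 2 of 2 of the 11:12:21Z INTENT (first refusal px13 g24 on the (0.4) combinatorics — no «NO»∕«MINE»; their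
centre-leg lineage ✓p820456∕✓p820802∕✓p821306∕✓p821341 treats the FIRST leg for the indices `S′`; the MIDDLE SEGMENT BOND used here is fresh for EVERY off-central index).

WHY (UV3-NODE §77.5 (R2), identity branch; pub-ymgap N09's (F2) «sharp guard integrated over …» in PRODUCT-measure currency).  In the triangular private-coordinate normal
form of one (0.4) step (lit ✓`BlockAveragingEMLHaarAC` §1) the guarded averaging `corr ℰ U c = if Small ℰ U c then ℰ.avg (loopHol U c) else 1` JUMPS exactly across the
frontier of `{U | Small ℰ U c}`, `Small ℰ U c = ∀ i, dist1 (loopHol U c i) < ℰ.δ`; reading the one-step transform of a continuous density for CONTINUITY (instead of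
absolute continuity) needs that jump locus to be null for product Haar measure.  It is: §5 below.

CONTENT.
* §4 (any `Params` in the standing range `j + 1 ≤ m + K`, any gauge group): `int_eq_of_cast_eq` (no wrap-around), `openWord_eq_split` (`Γ ∪ [x,x′] ∪ (−Γ′) =
  (Γ ++ h·(+μ)) ++ (+μ) :: (h·(+μ) ++ (−Γ′))`, `L = 2h+1`), `walkEnd_stair_replicate_apply`; ★★`exists_fresh_split_openWord`: for every coarse bond `c` and EVERY index `i`
  the walk of the OPEN word splits as `γ₁ ++ s₀ :: γ₂` with `s₀` the forward step over the middle segment bond `⟨emb c₋ + n + h e_μ, μ⟩` and NO step of `γ₁`, `γ₂` on that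
  bond (prefix-displacement boxes: lit ✓`netDisp_take_stairWord`, ✓`exists_take_of_mem_walk`, ✓`mem_walk_replicate`, ✓`flip_mem_walk_of_mem_walk_wordRev`; the μ-ranges of
  `Γ`, `Γ′` miss `n_μ + h`, the half-segments miss it by `1 … h` steps; no wrap-around by ✓`AveragingReflection.two_mul_L_le_sitesPerDir`); ★★`exists_fresh_split_loopWord`
  (OFF-CENTRAL `i`: the closing line `−c` is transversally off by `n_κ ≠ 0`).
* §5 ★★★`map_fieldMeasure_loopHol_eq_haar` ∕ ★★★`map_fieldMeasure_openHol_eq_haar` (any `G`: the `dU`-law of an off-central loop variable, resp. of EVERY open holonomy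
  `V_i`, IS Haar measure; FILE 1 `map_fieldMeasure_holAt_split_eq_haar`), px13 g24's ✓`…S1aFibreOpenMember.loopHol_of_isCentral` (`= 1`, lit FACT (B), cited by name); on `SU(n)`: ★★★`fieldMeasure_setOf_dist1_loopHol_eq_eq_zero`
  (EVERY index, `r ≠ 0`), ★★★`fieldMeasure_setOf_dist1_fibreFamily_eq_eq_zero` ∕ ★★`fieldMeasure_setOf_exists_dist1_fibreFamily_eq_delta_eq_zero` (the W-COORDINATE guard of
  lit ✓`BlockAveragingEMLHaarAC` §1: for every FIXED `W₀` the environments `U` whose guard boundary passes through `W₀` are null — the (R2)-identity statement in the resampled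
  currency), `frontier_setOf_forall_lt_subset` (generic topology), `continuous_dist1_su`, ★★★`fieldMeasure_frontier_small_eq_zero`: `dU (frontier {U | Small ℰ U c}) = 0`
  for every small-loop average `ℰ` and every `c`.

AS PRINTED vs AS TYPED (★p1).  Print integrates the formula (0.4) and never meets a guard (the average is «defined for configurations close to the identity», p. 253); the
tree's TOTAL guarded extension `corr` (cell row T4-D.L) creates the jump locus, and this file shows it is invisible to product Haar measure — the identity-branch half of
(R2) of §77.5's road to S1aᴴ's (c) residual; the EML-branch half ((R2)-EML: the analytic level set of the guarded preimage) and the Jacobian face (R1) are untouched.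

HONEST FRAMING.  Lattice-word combinatorics + measure zero bookkeeping; nothing of Bałaban's analysis is asserted or proved; `hreg` (§67.3 (c) for the full marginal) NOT asserted;
S1a(ᴴ) (m) AS TYPED misstated by currency (RULING №80) ∕ AS PRINTED OPEN; the five registered stubs of `Lines/semiclassical_s2beta.lean`, crux 20520 ∕ 19936 ∕ 19200 and
`YM3TorusSU2` are NOT proved; no registered stub is closed; registry untouched; rung R3 = SU(2) YM₃ on T³ at fixed lattice data — NOT d = 4, NOT infinite volume, NOT a mass
gap, NOT Clay; the Yang–Mills mass gap is NOT proved by any of this.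
References: [Balaban1987RG1] CMP 109 (1987) (0.3)–(0.4) pp. 252–253; [Balaban1985Averaging] CMP 98 (1985) (19) p. 21.
-/

set_option autoImplicit false

noncomputable section

namespace Summit.QuantumFields.YangMills.Theorems.FluctuationComparisonRegPrIntLS1aGuardSphereNull

open MeasureTheory Set Function
open scoped ENNReal
open Literature.MathematicalPhysics.QuantumFieldTheory.Balaban1983to89
open Summit.QuantumFields.YangMills.Theorems.FluctuationComparisonRegPrIntLS1aFreshLetterHaar

/-! ## §4 The loop words of (0.4): the middle bond of the transported segment is FRESH at every off-central index -/

section LoopWord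

open T4Continuum BlockAveraging BlockAveragingHaarAC

variable {P : Params} {j : ℕ}

/-- Integers congruent modulo `N` and closer than `N` are equal. [folklore] -/
theorem int_eq_of_cast_eq {N : ℕ} {a b : ℤ} (h : ((a : ℤ) : ZMod N) = (b : ℤ)) (hlt : |b - a| < N) : a = b := by
  have hdvd : ((N : ℕ) : ℤ) ∣ b - a := (ZMod.intCast_eq_intCast_iff_dvd_sub a b N).1 h
  have h0 := Int.eq_zero_of_abs_lt_dvd hdvd hlt
  omega

/-- **THE SPLIT OF THE OPEN WORD AT THE MIDDLE OF THE TRANSPORTED SEGMENT**: `Γ ∪ [x,x′] ∪ (−Γ′) = (Γ ++ h·(+μ)) ++ (+μ) :: (h·(+μ) ++ (−Γ′))` with `L = 2h + 1`.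
[folklore] -/
theorem openWord_eq_split (L : ℕ) {h : ℕ} (hL : 2 * h + 1 = L) {d : ℕ} (μ : Fin d) (n : Fin d → ℤ) (σ σ' : Equiv.Perm (Fin d)) :
    openWord L μ n σ σ' = (stairWord σ n ++ List.replicate h (μ, true)) ++
      ((μ, true) :: (List.replicate h (μ, true) ++ wordRev (stairWord σ' n))) := by
  have hrep : List.replicate L (μ, true) = List.replicate h (μ, true) ++ ((μ, true) :: List.replicate h (μ, true)) := by
    rw [← List.replicate_succ, ← List.replicate_add]; congr 1; omega
  unfold openWord
  rw [hrep]
  simp only [List.append_assoc, List.cons_append]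

variable (hj : j + 1 ≤ P.m + P.K)
include hj

omit hj in
/-- The site `y + n + t e_μ` reached after a staircase to `n` and `t` steps `+μ`, in coordinates. [folklore] -/
theorem walkEnd_stair_replicate_apply (y : Site P j) (μ : Fin P.d) (n : Fin P.d → ℤ) (σ : Equiv.Perm (Fin P.d)) (t : ℕ)
    (ν : Fin P.d) :
    walkEnd y (stairWord σ n ++ List.replicate t (μ, true)) ν =
      y ν + (((n ν + if μ = ν then (t : ℤ) else 0 : ℤ)) : ZMod (P.sitesPerDir j)) := by
  rw [walkEnd_apply, T4ReflectionCone.netDisp_append, netDisp_stairWord, T4ReflectionCone.netDisp_replicate]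
  by_cases h : μ = ν <;> simp [h]

/-- ★★ **THE MIDDLE SEGMENT BOND IS FRESH IN THE OPEN WORD** at every off-central index: the walk of `Γ ∪ [x,x′] ∪ (−Γ′)` from `emb c₋` splits as `γ₁ ++ s₀ :: γ₂` with `s₀`
the FORWARD step over `b_i = ⟨emb c₋ + n + h·e_μ, μ⟩` and NO step of `γ₁`, `γ₂` on `b_i` (prefix-displacement boxes: `Γ`'s and `Γ′`'s μ-ranges miss `n_μ + h`, the two
half-segments miss it by `1 ≤ · ≤ h` steps; no wrap-around since `2L ≤` sites per direction; `x` off the line of `c` is not even needed here). [cite: Balaban1987RG1, (0.4) p.253] -/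
theorem exists_fresh_split_openWord (c : PBond P (j + 1)) (i : Idx P) :
    ∃ (γ₁ γ₂ : List (LStep P j)) (s₀ : LStep P j),
      walk (emb c.src) (openWord P.L c.dir (off i.1) i.2.1 i.2.2) = γ₁ ++ s₀ :: γ₂ ∧ s₀.fwd = true ∧
      s₀.bond = ⟨walkEnd (emb c.src) (stairWord i.2.1 (off i.1) ++ List.replicate ((P.L - 1) / 2) (c.dir, true)), c.dir⟩ ∧
      (∀ s ∈ γ₁, s.bond ≠ s₀.bond) ∧ (∀ s ∈ γ₂, s.bond ≠ s₀.bond) := by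
  classical
  -- names
  obtain ⟨h, hhdef⟩ : ∃ h : ℕ, h = (P.L - 1) / 2 := ⟨_, rfl⟩
  have hL : 2 * h + 1 = P.L := by rw [hhdef]; exact AveragingRT.two_mul_half_add_one P
  have hL1 : 1 < P.L := P.hL.2
  have hh1 : 1 ≤ h := by omega
  have hN : 2 * P.L ≤ P.sitesPerDir j := AveragingReflection.two_mul_L_le_sitesPerDir hj
  set μ := c.dir with hμ
  set n : Fin P.d → ℤ := off i.1 with hn
  have hnb : ∀ κ, -(h : ℤ) ≤ n κ ∧ n κ ≤ h := fun κ => by rw [hn, hhdef]; exact off_bounds i.1 κ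
  set Γ := stairWord i.2.1 n with hΓ
  set Γ' := stairWord i.2.2 n with hΓ'
  set y₀ : Site P j := emb c.src with hy₀
  set xh : Site P j := walkEnd y₀ (Γ ++ List.replicate h (μ, true)) with hxh
  set tail : List (Letter P.d) := List.replicate h (μ, true) ++ wordRev Γ' with htail
  -- the split
  have hsplit : walk y₀ (openWord P.L μ n i.2.1 i.2.2) =
      walk y₀ (Γ ++ List.replicate h (μ, true)) ++ (⟨⟨xh, μ⟩, true⟩ :: walk (xh.shift μ) tail) := by
    rw [openWord_eq_split P.L hL μ n i.2.1 i.2.2, walk_append]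
    rfl
  rw [← hhdef]
  refine ⟨walk y₀ (Γ ++ List.replicate h (μ, true)), walk (xh.shift μ) tail, ⟨⟨xh, μ⟩, true⟩, hsplit, rfl, rfl, ?_, ?_⟩
  · -- γ₁ = walk y₀ Γ ++ walk x (h·(+μ))
    intro s hs hsb
    rw [walk_append, List.mem_append] at hs
    have hsrc : ∀ ν, s.bond.src ν = xh ν := fun ν => by rw [hsb]
    have hdir : s.bond.dir = μ := by rw [hsb]
    have hxμ : xh μ = y₀ μ + (((n μ + h : ℤ)) : ZMod (P.sitesPerDir j)) := by
      rw [hxh, walkEnd_stair_replicate_apply]; simp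
    rcases hs with hs | hs
    · -- a staircase step: both endpoints are prefix ends of `Γ`
      obtain ⟨k₁, k₂, h1, h2⟩ := exists_take_of_mem_walk y₀ Γ s hs
      have hb1 := netDisp_take_stairWord i.2.1 n μ k₁
      have hb2 := netDisp_take_stairWord i.2.1 n μ k₂
      rw [← hΓ] at hb1 hb2
      have h2μ := h2 μ
      rw [hdir, if_pos rfl] at h2μ
      have e1 := h1 μ
      rw [hsrc μ, hxμ, add_left_cancel_iff] at e1
      have hnμ := hnb μ
      have heq : netDisp (Γ.take k₁) μ = n μ + h := by
        refine (int_eq_of_cast_eq e1.symm ?_)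
        rw [abs_lt]; constructor <;> omega
      omega
    · -- a step of the first half-segment: source `x + t′ e_μ`, `t′ < h`
      obtain ⟨-, -, t', ht', hst⟩ := mem_walk_replicate hs
      have e1 := hst μ
      rw [hsrc μ, if_pos rfl] at e1
      have hx : walkEnd y₀ Γ μ = y₀ μ + ((n μ : ℤ) : ZMod (P.sitesPerDir j)) := by
        rw [walkEnd_apply, netDisp_stairWord]
      rw [hxμ, hx, add_assoc, add_left_cancel_iff, ← Int.cast_natCast, ← Int.cast_add] at e1
      have heq : (n μ + h : ℤ) = n μ + (t' : ℤ) := int_eq_of_cast_eq e1 (by rw [abs_lt]; constructor <;> omega)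
      omega
  · -- γ₂ = walk (xh+e_μ) (h·(+μ)) ++ walk x′ (−Γ′)
    intro s hs hsb
    have hsrc : ∀ ν, s.bond.src ν = xh ν := fun ν => by rw [hsb]
    have hdir : s.bond.dir = μ := by rw [hsb]
    have hxν : ∀ ν, xh ν = y₀ ν + (((n ν + if μ = ν then (h : ℤ) else 0 : ℤ)) : ZMod (P.sitesPerDir j)) := fun ν => by
      rw [hxh, walkEnd_stair_replicate_apply]
    rw [htail, walk_append, List.mem_append] at hs
    rcases hs with hs | hs
    · -- second half-segment: source `xh + (1 + t′) e_μ`, `t′ < h`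
      obtain ⟨-, -, t', ht', hst⟩ := mem_walk_replicate hs
      have e1 := hst μ
      rw [hsrc μ, if_pos rfl, Site.shift, Function.update_self, add_assoc] at e1
      have e2 : ((0 : ℤ) : ZMod (P.sitesPerDir j)) = ((1 + t' : ℤ) : ZMod (P.sitesPerDir j)) := by
        have := e1; push_cast at this ⊢; linear_combination this
      have heq : (0 : ℤ) = 1 + t' := int_eq_of_cast_eq e2 (by rw [abs_lt]; constructor <;> omega)
      omega
    · -- a step of `−Γ′`: the base of `−Γ′` is `x′ = xh + (h+1) e_μ`, the END of `Γ′` walked from `emb c₊ = y₀ + L e_μ`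
      set y₁ : Site P j := walkEnd y₀ (List.replicate P.L (μ, true)) with hy₁
      have hy₁ν : ∀ ν, y₁ ν = y₀ ν + (((if μ = ν then (P.L : ℤ) else 0 : ℤ)) : ZMod (P.sitesPerDir j)) := fun ν => by
        rw [hy₁, walkEnd_apply, T4ReflectionCone.netDisp_replicate]; by_cases hμν : μ = ν <;> simp [hμν]
      have hx' : walkEnd (xh.shift μ) (List.replicate h (μ, true)) = walkEnd y₁ Γ' := by
        funext ν
        rw [walkEnd_apply, T4ReflectionCone.netDisp_replicate, walkEnd_apply, netDisp_stairWord, hy₁ν ν, Site.shift]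
        by_cases hμν : μ = ν
        · subst hμν
          rw [Function.update_self, hxν]; simp only [if_true]; push_cast
          have : (P.L : ℤ) = 2 * h + 1 := by exact_mod_cast hL.symm
          rw [show ((P.L : ℕ) : ZMod (P.sitesPerDir j)) = ((P.L : ℤ) : ZMod (P.sitesPerDir j)) by push_cast; rfl, this]
          push_cast; ring
        · rw [Function.update_of_ne (Ne.symm hμν), hxν]; simp only [if_neg hμν]; push_cast; ring
      rw [hx'] at hs
      have hs' := flip_mem_walk_of_mem_walk_wordRev y₁ Γ' s hs
      obtain ⟨k₁, k₂, h1, h2⟩ := exists_take_of_mem_walk y₁ Γ' _ hs'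
      simp only at h1 h2
      have hb1 := netDisp_take_stairWord i.2.2 n μ k₁
      have hb2 := netDisp_take_stairWord i.2.2 n μ k₂
      rw [← hΓ'] at hb1 hb2
      have h2μ := h2 μ
      rw [hdir, if_pos rfl] at h2μ
      have e1 := h1 μ
      rw [hsrc μ, hxν μ, hy₁ν μ, if_pos rfl, if_pos rfl, add_assoc, add_left_cancel_iff, ← Int.cast_add] at e1
      have hnμ := hnb μ
      have hLz : (P.L : ℤ) = 2 * h + 1 := by exact_mod_cast hL.symm
      have heq : (n μ + h : ℤ) = (P.L : ℤ) + netDisp (Γ'.take k₁) μ := by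
        refine int_eq_of_cast_eq e1 ?_
        rw [abs_lt]; constructor <;> omega
      omega

/-- ★★ **THE MIDDLE SEGMENT BOND IS FRESH IN THE LOOP WORD** at every OFF-CENTRAL index: the walk of `Γ ∪ [x,x′] ∪ (−Γ′) ∪ (−c)` splits as `γ₁ ++ s₀ :: γ₂` with `s₀` the
forward step over `⟨emb c₋ + n + h·e_μ, μ⟩` and no other step on that bond (the open word by the previous theorem; the closing line `−c` is transversally off by `n_κ ≠ 0`).
[cite: Balaban1987RG1, (0.4) p.253] -/
theorem exists_fresh_split_loopWord (c : PBond P (j + 1)) (i : Idx P) (hi : ¬ IsCentral c i) :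
    ∃ (γ₁ γ₂ : List (LStep P j)) (s₀ : LStep P j),
      walk (emb c.src) (loopWord P.L c.dir (off i.1) i.2.1 i.2.2) = γ₁ ++ s₀ :: γ₂ ∧ s₀.fwd = true ∧
      (∀ s ∈ γ₁, s.bond ≠ s₀.bond) ∧ (∀ s ∈ γ₂, s.bond ≠ s₀.bond) := by
  classical
  obtain ⟨γ₁, γ₂, s₀, hsplit, hfwd, hs₀, h₁, h₂⟩ := exists_fresh_split_openWord hj c i
  have hN : 2 * P.L ≤ P.sitesPerDir j := AveragingReflection.two_mul_L_le_sitesPerDir hj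
  have hL1 : 1 < P.L := P.hL.2
  have hnb : ∀ κ, -((((P.L - 1) / 2 : ℕ)) : ℤ) ≤ off i.1 κ ∧ off i.1 κ ≤ (((P.L - 1) / 2 : ℕ) : ℤ) := fun κ => off_bounds i.1 κ
  have hhL := AveragingRT.two_mul_half_add_one P
  refine ⟨γ₁, γ₂ ++ walk (walkEnd (emb c.src) (openWord P.L c.dir (off i.1) i.2.1 i.2.2)) (List.replicate P.L (c.dir, false)), s₀, ?_, hfwd, h₁, ?_⟩
  · rw [loopWord_eq_openWord_append, walk_append, hsplit, List.append_assoc, List.cons_append]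
  · intro s hs
    rw [List.mem_append] at hs
    rcases hs with hs | hs
    · exact h₂ s hs
    · -- a step of the closing line `−c`: flipped, it is a step of the forward line from `emb c₋`; transversally off
      intro hsb
      rw [walkEnd_openWord, replicate_false_eq_wordRev] at hs
      have hs' := flip_mem_walk_of_mem_walk_wordRev (emb c.src) _ s hs
      obtain ⟨-, -, t', -, hst⟩ := mem_walk_replicate hs'
      simp only at hst
      obtain ⟨κ, hκμ, hκ⟩ : ∃ κ, κ ≠ c.dir ∧ off i.1 κ ≠ 0 := by
        obtain ⟨κ, hκ⟩ := not_forall.mp hi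
        exact ⟨κ, (Classical.not_imp.mp hκ).1, (Classical.not_imp.mp hκ).2⟩
      have e1 := hst κ
      have hxκ : s₀.bond.src κ = emb c.src κ + (((off i.1 κ + if c.dir = κ then ((((P.L - 1) / 2 : ℕ)) : ℤ) else 0 : ℤ)) : ZMod (P.sitesPerDir j)) := by
        rw [hs₀]; exact walkEnd_stair_replicate_apply (emb c.src) c.dir (off i.1) i.2.1 _ κ
      rw [hsb, hxκ, if_neg (Ne.symm hκμ), if_neg hκμ, add_zero, add_left_cancel_iff] at e1
      have hnκ := hnb κ
      have heq : (off i.1 κ : ℤ) = 0 := int_eq_of_cast_eq e1 (by rw [abs_lt]; constructor <;> omega)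
      exact hκ heq

end LoopWord

/-! ## §5 Consequences for the (0.4) loop variables: Haar law, null spheres, null guard frontier -/

section Loop

open T4Continuum BlockAveraging BlockAveragingHaarAC

variable {P : Params} {j : ℕ} (hj : j + 1 ≤ P.m + P.K)
include hj

section AnyGroup

variable {G : Type*} [GaugeGroup G] [MeasurableSpace G] [RegularGaugeGroup G] [HaarData G]

/-- ★★★ **EVERY OFF-CENTRAL LOOP VARIABLE OF (0.4) IS HAAR-DISTRIBUTED UNDER PRODUCT HAAR MEASURE** (any gauge group with the tree's `HaarData`): the law of
`U ↦ U(Γ ∪ [x,x′] ∪ (−Γ′) ∪ (−c))` is Haar measure for every coarse bond `c` and every index `i` with `x` off the line of `c`. [cite: Balaban1987RG1, (0.4) p.253] -/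
theorem map_fieldMeasure_loopHol_eq_haar (c : PBond P (j + 1)) (i : Idx P) (hi : ¬ IsCentral c i) :
    (fieldMeasure P j G).map (fun U : GaugeField P j G => loopHol U c i) = HaarData.haar := by
  classical
  obtain ⟨γ₁, γ₂, s₀, hsplit, -, h₁, h₂⟩ := exists_fresh_split_loopWord hj c i hi
  have hfun : (fun U : GaugeField P j G => loopHol U c i) = fun U => holAt U (γ₁ ++ s₀ :: γ₂) := by
    funext U; unfold loopHol; rw [hsplit]
  rw [hfun]
  exact map_fieldMeasure_holAt_split_eq_haar γ₁ γ₂ s₀ h₁ h₂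

/-- ★★★ **EVERY OPEN HOLONOMY `V_i = U(Γ ∪ [x,x′] ∪ (−Γ′))` OF (0.4) IS HAAR-DISTRIBUTED UNDER PRODUCT HAAR MEASURE** (any gauge group, EVERY index — the middle segment
bond is fresh in the open word even at central indices). [cite: Balaban1987RG1, (0.4) p.253] -/
theorem map_fieldMeasure_openHol_eq_haar (c : PBond P (j + 1)) (i : Idx P) :
    (fieldMeasure P j G).map (fun U : GaugeField P j G => openHol U c i) = HaarData.haar := by
  classical
  obtain ⟨γ₁, γ₂, s₀, hsplit, -, -, h₁, h₂⟩ := exists_fresh_split_openWord hj c i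
  have hfun : (fun U : GaugeField P j G => openHol U c i) = fun U => holAt U (γ₁ ++ s₀ :: γ₂) := by
    funext U; unfold openHol; rw [hsplit]
  rw [hfun]
  exact map_fieldMeasure_holAt_split_eq_haar γ₁ γ₂ s₀ h₁ h₂

end AnyGroup

section SU

variable {n : Type*} [Fintype n] [DecidableEq n] [Nonempty n]

/-- ★★★ **THE `dist1`-SPHERES OF EVERY (0.4) LOOP VARIABLE ARE PRODUCT-HAAR-NULL** on `SU(n)`: `dU {U | dist1 U(Γ ∪ [x,x′] ∪ (−Γ′) ∪ (−c)) = r} = 0` for every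
`r ≠ 0`, every coarse bond and EVERY index (off-central: Haar law + lit ✓`haar_setOf_dist1_eq_eq_zero_specialUnitaryGroup`; central: the loop variable is `1` and `dist1 1 = 0 ≠ r`).
[cite: Balaban1985Averaging, (19) p.21] -/
theorem fieldMeasure_setOf_dist1_loopHol_eq_eq_zero (c : PBond P (j + 1)) (i : Idx P) {r : ℝ} (hr : r ≠ 0) :
    fieldMeasure P j ↥(Matrix.specialUnitaryGroup n ℂ) {U | dist1 (loopHol U c i) = r} = 0 := by
  classical
  by_cases hi : IsCentral c i
  · have he : {U : GaugeField P j ↥(Matrix.specialUnitaryGroup n ℂ) | dist1 (loopHol U c i) = r} = ∅ := by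
      ext U
      simp only [Set.mem_setOf_eq, Set.mem_empty_iff_false, iff_false, Summit.QuantumFields.YangMills.Theorems.FluctuationComparisonRegPrIntLS1aFibreOpenMember.loopHol_of_isCentral U c i hi,
        GaugeGroup.dist1_one]
      exact fun h => hr h.symm
    rw [he, measure_empty]
  · have hm : Measurable fun U : GaugeField P j ↥(Matrix.specialUnitaryGroup n ℂ) => loopHol U c i :=
      measurable_holAt (walk (emb c.src) (loopWord P.L c.dir (off i.1) i.2.1 i.2.2))
    have h := fieldMeasure_setOf_dist1_mul_eq_eq_zero hm (map_fieldMeasure_loopHol_eq_haar hj c i hi) 1 hr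
    simpa only [mul_one] using h

/-- ★★★ **THE W-COORDINATE GUARD SPHERES ARE PRODUCT-HAAR-NULL FOR EVERY FIXED `W₀`** (UV3-NODE §77.5 (R2), identity branch, in the resampled currency of
lit ✓`BlockAveragingEMLHaarAC` §1): for every coarse bond `c`, index `i`, `W₀ ∈ SU(n)` and `r ≠ 0`, `dU {U | dist1 (fibreFamily U c W₀ i) = r} = 0` — off-central indices:
`fibreFamily U c W₀ i = V_i(U)·W₀⁻¹` with `V_i` Haar-distributed; central ones: `= 1`.  So for a FIXED coarse value `W₀` of the private variable the set of «environments» `U` whose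
W-guard `fibreGuard ℰ U c` has `W₀` on one of its bounding spheres is null. [cite: Balaban1987RG1, (0.4) p.253] -/
theorem fieldMeasure_setOf_dist1_fibreFamily_eq_eq_zero (c : PBond P (j + 1)) (i : Idx P) (W₀ : ↥(Matrix.specialUnitaryGroup n ℂ)) {r : ℝ} (hr : r ≠ 0) :
    fieldMeasure P j ↥(Matrix.specialUnitaryGroup n ℂ) {U | dist1 (BlockAveragingEMLHaarAC.fibreFamily U c W₀ i) = r} = 0 := by
  classical
  by_cases hi : IsCentral c i
  · have he : {U : GaugeField P j ↥(Matrix.specialUnitaryGroup n ℂ) | dist1 (BlockAveragingEMLHaarAC.fibreFamily U c W₀ i) = r} = ∅ := by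
      ext U
      simp only [Set.mem_setOf_eq, Set.mem_empty_iff_false, iff_false, BlockAveragingEMLHaarAC.fibreFamily_of_isCentral U c W₀ i hi,
        GaugeGroup.dist1_one]
      exact fun h => hr h.symm
    rw [he, measure_empty]
  · have hm : Measurable fun U : GaugeField P j ↥(Matrix.specialUnitaryGroup n ℂ) => openHol U c i :=
      measurable_holAt (walk (emb c.src) (openWord P.L c.dir (off i.1) i.2.1 i.2.2))
    have h := fieldMeasure_setOf_dist1_mul_eq_eq_zero hm (map_fieldMeasure_openHol_eq_haar hj c i) W₀⁻¹ hr
    have he : {U : GaugeField P j ↥(Matrix.specialUnitaryGroup n ℂ) | dist1 (BlockAveragingEMLHaarAC.fibreFamily U c W₀ i) = r} =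
        {U | dist1 (openHol U c i * W₀⁻¹) = r} := by
      ext U; rw [Set.mem_setOf_eq, Set.mem_setOf_eq, BlockAveragingEMLHaarAC.fibreFamily_of_not_isCentral U c W₀ i hi]
    rw [he]; exact h

/-- ★★ **…hence the set of environments whose W-guard boundary passes through a fixed `W₀` is null**: `dU {U | ∃ i, dist1 (fibreFamily U c W₀ i) = ℰ.δ} = 0`
(finite union over the index set). [cite: Balaban1987RG1, (0.4) p.253] -/
theorem fieldMeasure_setOf_exists_dist1_fibreFamily_eq_delta_eq_zero (ℰ : LoopAverage ↥(Matrix.specialUnitaryGroup n ℂ)) (c : PBond P (j + 1))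
    (W₀ : ↥(Matrix.specialUnitaryGroup n ℂ)) :
    fieldMeasure P j ↥(Matrix.specialUnitaryGroup n ℂ) {U | ∃ i, dist1 (BlockAveragingEMLHaarAC.fibreFamily U c W₀ i) = ℰ.δ} = 0 := by
  have he : {U : GaugeField P j ↥(Matrix.specialUnitaryGroup n ℂ) | ∃ i, dist1 (BlockAveragingEMLHaarAC.fibreFamily U c W₀ i) = ℰ.δ} =
      ⋃ i, {U | dist1 (BlockAveragingEMLHaarAC.fibreFamily U c W₀ i) = ℰ.δ} := by
    ext U; simp only [Set.mem_setOf_eq, Set.mem_iUnion]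
  rw [he]
  exact measure_iUnion_null_iff.2 fun i => fieldMeasure_setOf_dist1_fibreFamily_eq_eq_zero hj c i W₀ ℰ.δ_pos.ne'

omit hj in
/-- The frontier of a finite intersection of strict sub-level sets of continuous functions lies on the union of the exact level sets. [folklore] -/
theorem frontier_setOf_forall_lt_subset {X : Type*} [TopologicalSpace X] {ι : Type*} [Finite ι] (f : ι → X → ℝ) (hf : ∀ i, Continuous (f i))
    (δ : ℝ) : frontier {x | ∀ i, f i x < δ} ⊆ ⋃ i, {x | f i x = δ} := by
  intro x hx
  have hopen : IsOpen {x : X | ∀ i, f i x < δ} := by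
    rw [Set.setOf_forall]
    exact isOpen_iInter_of_finite fun i => isOpen_lt (hf i) continuous_const
  have hclosed : IsClosed {x : X | ∀ i, f i x ≤ δ} := by
    rw [Set.setOf_forall]
    exact isClosed_iInter fun i => isClosed_le (hf i) continuous_const
  rw [hopen.frontier_eq, Set.mem_sdiff] at hx
  obtain ⟨hcl, hnot⟩ := hx
  have hle : ∀ i, f i x ≤ δ := by
    have hsub : closure {x : X | ∀ i, f i x < δ} ⊆ {x | ∀ i, f i x ≤ δ} :=
      closure_minimal (fun y hy i => (hy i).le) hclosed
    exact hsub hcl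
  simp only [Set.mem_setOf_eq, not_forall, not_lt] at hnot
  obtain ⟨i, hi⟩ := hnot
  exact Set.mem_iUnion.2 ⟨i, le_antisymm (hle i) hi⟩

omit hj in
/-- `dist1` is continuous on `SU(n)` (operator norm of `U − 1`). [cite: Balaban1985Averaging, (19) p.21] -/
theorem continuous_dist1_su : Continuous (dist1 : ↥(Matrix.specialUnitaryGroup n ℂ) → ℝ) :=
  UnitaryModel.continuous_opDist1.comp (Literature.MathematicalPhysics.QuantumLattice.continuous_fundamentalRep n)

/-- ★★★ **THE FRONTIER OF THE SMALL-FIELD GUARD OF (0.4) IS PRODUCT-HAAR-NULL**: for every small-loop average `ℰ` on `SU(n)` and every coarse bond `c`,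
`dU (frontier {U | Small ℰ U c}) = 0` — the frontier lies on the finitely many spheres `{dist1 U(loop_i) = δ}` (`Small` = finitely many strict inequalities between
continuous functions, lit ✓`continuous_holAt`), each null by the previous theorem (`δ > 0`).  This is the identity-branch half of UV3-NODE §77.5 (R2): the set of fine
fields at which the guarded averaging `corr ℰ` of (0.4) jumps has measure zero. [cite: Balaban1987RG1, (0.4) p.253] -/
theorem fieldMeasure_frontier_small_eq_zero (ℰ : LoopAverage ↥(Matrix.specialUnitaryGroup n ℂ)) (c : PBond P (j + 1)) :
    fieldMeasure P j ↥(Matrix.specialUnitaryGroup n ℂ) (frontier {U | Small ℰ U c}) = 0 := by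
  have hsub := frontier_setOf_forall_lt_subset (X := GaugeField P j ↥(Matrix.specialUnitaryGroup n ℂ))
    (fun (i : Idx P) (U : GaugeField P j ↥(Matrix.specialUnitaryGroup n ℂ)) => dist1 (loopHol U c i))
    (fun i => continuous_dist1_su.comp (BlockAveraging.continuous_holAt _)) ℰ.δ
  refine measure_mono_null hsub ?_
  exact (measure_iUnion_null_iff.2 fun i => fieldMeasure_setOf_dist1_loopHol_eq_eq_zero hj c i ℰ.δ_pos.ne')

end SU

end Loop

end Summit.QuantumFields.YangMills.Theorems.FluctuationComparisonRegPrIntLS1aGuardSphereNull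

end
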